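import Summits.QuantumFields.QCD.Theorems.QuarksAsStableActionStableActionBridgeDefs
import Literature.MathematicalPhysics.QuantumFieldTheory.QCDCalibratedSpecies
import Literature.MathematicalPhysics.QuantumFieldTheory.QCDTorusTranslation
import Literature.MathematicalPhysics.QuantumFieldTheory.SchwingerLimitInheritance
import Summits.QuantumFields.YangMills.Theorems.LangevinControlUVOSLegsAtWeakCouplingCStubRopeCutoff
import Summits.QuantumFields.YangMills.Theorems.ParabolicTrajectoryContinuumLimitOnTrajectoryStubTranslA
import HarnessLib

/-!
# Stub `stub_asymptoticTranslation` of line `birth`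
(crux `Summit.QuantumFields.QCD.Theses.GapBuysCauchyRate.ConvergentOSClosure`,
item stmt-QuantumFields-11525, route route-QuantumFields-GapBuysCauchyRate)

**Asymptotic translation invariance on `⁰𝒮` of the canonical lattice distributions of lattice QCD**
(input P6 of the soft OS closure): along any scheme `sch` whose lattice `n`-point distributions
`qcdLatticeDist sch k n σ` obey a k-uniform E0′ bound `‖qcdLatticeDist sch k n σ G‖ ≤ C |G|_N` on `⁰𝒮ₙ`
(eventually in `k`), for every translation `a ∈ ℝ⁴` and every `F ∈ ⁰𝒮ₙ`,
`qcdLatticeDist sch k n σ (F(· − a)) − qcdLatticeDist sch k n σ F → 0`.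

Proof (Glimm–Jaffe 1987 §6.1; Osterwalder–Schrader 1975 §4; Osterwalder–Seiler 1978 §2).
1. *Exact lattice step.*  The torus moments `W_σ(x) = qcdTorusMomentStr sch k σ x` are invariant under the
   SIMULTANEOUS shift of all insertion sites by a lattice vector `v ∈ ℤ⁴`
   (`qcdTorusMomentStr_add_const`): placing an insertion at `y + v` is the quark translation by `v mod S`
   of its placement at `y` in the back-translated gauge field (`insertion_add_eq_quarkTranslate`: the
   periodic lift intertwines the translations for `glue`, the quark variables are relabelled for the mesons),
   the quark translation is an algebra automorphism (so it passes through the ordered product), and the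
   honest periodic functional is translation covariant (tree `qcdTorusExpect_quarkTranslate`).  Hence for a
   test function `G` supported in the ball of radius `R` and `k` with `R + a_k ‖v‖_∞ ≤ a_k L_k` the finite sum
   `∑ₓ W_σ(x) G(a_k x − a_k v)` over the box re-indexes to `∑_y W_σ(y) G(a_k y)`
   (`qcdLatticeDist_translateMulti_lattice_eq`): EXACT invariance under `τ_{a_k v}`.
2. *Four-term split.*  With lattice vectors `a_k v_k → a` (coordinatewise rounding of `a / a_k`) and compact
   off-diagonal cutoffs `G_j → F` in `𝓢` (`exists_offDiagonal_cutoff_tendsto`),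
   `u_k(τ_a F) − u_k F = u_k(τ_a F − τ_{a_k v_k} F) + u_k(τ_{a_k v_k}(F − G_j)) + [u_k(τ_{a_k v_k} G_j) − u_k G_j]
   + u_k(G_j − F)`; the bracket vanishes for `k` large (step 1, `a_k L_k → ∞`), the other three terms are
   `≤ C ×` Schwartz norms that are small by strong continuity of translations on `𝓢`
   (`continuous_translateMulti`), by `G_j → F` and by the polynomial bound
   `|τ_b G|_N ≤ (2(1 + ‖b‖))^N |G|_N` (`schwartzNorm_translateMulti_le`), all inputs being off-diagonal.
Degree `0`: both distributions are evaluation at the unique point.  Everything is proved; no named fact.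
-/

noncomputable section

open scoped BigOperators Topology SchwartzMap
open MeasureTheory Filter
open Literature.MathematicalPhysics.AQFT Literature.MathematicalPhysics.QuantumLattice
  Literature.MathematicalPhysics.QuantumFieldTheory
open Literature.Probability.LatticeModels (box Site TorusSite mem_box Torus.proj)
open Summit.QuantumFields.QCD.Cruxes.StableActionBridge.Sketch

namespace Summit.QuantumFields.QCD.Theorems.ConvergentOSClosure

/-! ### Exact simultaneous translation covariance of the torus moments -/

section Torus

variable {Nf S : ℕ} [NeZero S]

/-- Translating the quark variables moves the pseudoscalar bilinear: `u · P_{fg}(x) = P_{fg}(x + u)`. -/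
theorem quarkTranslate_pseudoscalarBilinear (u : TorusSite 4 S) (f g : Fin Nf) (x : TorusSite 4 S) :
    quarkTranslate Nf u (pseudoscalarBilinear f g x) = pseudoscalarBilinear f g (x + u) := by
  simp only [pseudoscalarBilinear, map_sum, map_smul, map_mul, quarkTranslate_qbar, quarkTranslate_q]

/-- **Placing a species insertion at `y + v` is translating its placement at `y`**:
`insertion U s (y + v) = v̄ · insertion (τ_{-v̄} U) s y`, `v̄ = v mod S` (glue: the periodic lift intertwines
the translations and the density is a scalar; mesons: relabelling of the quark variables). -/
theorem insertion_add_eq_quarkTranslate (U : GaugeConfig 4 S (Matrix.specialUnitaryGroup (Fin 3) ℂ)) (s : QCDField Nf)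
    (y v : Site 4) :
    insertion U s (y + v) = quarkTranslate Nf (Torus.proj S v)
      (insertion (TorusTranslation.torusConfigShift (-Torus.proj S v) U) s y) := by
  cases s with
  | glue =>
    simp only [insertion, AlgHom.commutes]
    rw [neg_add, configShift_add', configShift_torusLift, torusProj_neg']
  | pseudoRe f g =>
    simp only [insertion, map_smul, map_add, quarkTranslate_pseudoscalarBilinear, torusProj_add']
  | pseudoIm f g =>
    simp only [insertion, map_smul, map_sub, quarkTranslate_pseudoscalarBilinear, torusProj_add']

end Torus

variable {Nf : ℕ}

/-- The renormalised centred insertion at `y + v` is the quark translate of the one at `y` in the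
back-translated gauge field. -/
theorem renormInsertion_add_eq_quarkTranslate (sch : QCDScheme Nf) (k : ℕ) (s : QCDField Nf)
    (y v : Site 4) (U : GaugeConfig 4 (sch.side k) (Matrix.specialUnitaryGroup (Fin 3) ℂ)) :
    renormInsertion sch k s (y + v) U = quarkTranslate Nf (Torus.proj (sch.side k) v)
      (renormInsertion sch k s y (TorusTranslation.torusConfigShift (-Torus.proj (sch.side k) v) U)) := by
  unfold renormInsertion
  rw [map_smul, map_sub, AlgHom.commutes, insertion_add_eq_quarkTranslate]

/-- `qcdTorusMomentStr` is the honest torus expectation `qcdTorusExpect` of the ordered product of the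
renormalised insertions (definitional unfolding). -/
theorem qcdTorusMomentStr_eq_qcdTorusExpect (sch : QCDScheme Nf) (k : ℕ) {n : ℕ}
    (σ : Fin n → QCDField Nf) (x : Fin n → Site 4) :
    qcdTorusMomentStr sch k σ x = qcdTorusExpect (sch.β k) (sch.side k) (fun fl => sch.mq fl k)
      (fun U => (List.ofFn fun i => renormInsertion sch k (σ i) (x i) U).prod) :=
  rfl

/-- **Simultaneous translation invariance of the torus moments**: shifting ALL insertion sites by the
same lattice vector `v ∈ ℤ⁴` does not change `W_σ` — exact translation covariance of the honest periodic
functional (`qcdTorusExpect_quarkTranslate`) applied to the ordered product of the insertions. -/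
theorem qcdTorusMomentStr_add_const (sch : QCDScheme Nf) (k : ℕ) {n : ℕ} (σ : Fin n → QCDField Nf)
    (x : Fin n → Site 4) (v : Site 4) :
    qcdTorusMomentStr sch k σ (fun i => x i + v) = qcdTorusMomentStr sch k σ x := by
  rw [qcdTorusMomentStr_eq_qcdTorusExpect, qcdTorusMomentStr_eq_qcdTorusExpect]
  have h : ∀ U : GaugeConfig 4 (sch.side k) (Matrix.specialUnitaryGroup (Fin 3) ℂ),
      (List.ofFn fun i => renormInsertion sch k (σ i) (x i + v) U).prod =
        quarkTranslate Nf (Torus.proj (sch.side k) v)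
          ((List.ofFn fun i => renormInsertion sch k (σ i) (x i)
            (TorusTranslation.torusConfigShift (-Torus.proj (sch.side k) v) U)).prod) := by
    intro U
    rw [map_list_prod, List.map_ofFn]
    exact congrArg (fun l => List.prod l) (congrArg List.ofFn (funext fun i =>
      renormInsertion_add_eq_quarkTranslate sch k (σ i) (x i) v U))
  simp only [h]
  exact qcdTorusExpect_quarkTranslate (sch.β k) (fun fl => sch.mq fl k) (Torus.proj (sch.side k) v)
    (fun V => (List.ofFn fun i => renormInsertion sch k (σ i) (x i) V).prod)

/-! ### The exact lattice step: invariance of `qcdLatticeDist` under lattice translations inside the box -/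

/-- **Exact invariance of the lattice distribution under lattice translations inside the box.**  If `G` is
supported in the closed ball of radius `R` and `R + a_k |v_μ| ≤ a_k L_k` for every coordinate `μ`, then
`qcdLatticeDist sch k n σ (G(· − a_k v)) = qcdLatticeDist sch k n σ G` (`n ≥ 1`): the finite sum over the box
re-indexes by `x ↦ x − v` on the support, and the weights are simultaneously translation invariant. -/
theorem qcdLatticeDist_translateMulti_lattice_eq (sch : QCDScheme Nf) (k : ℕ) {n : ℕ} (hn : n ≠ 0)
    (σ : Fin n → QCDField Nf) (v : Site 4) (G : 𝓢((Fin n → EuclideanSpace ℝ (Fin 4)), ℂ)) {R : ℝ}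
    (hG : tsupport (G : (Fin n → EuclideanSpace ℝ (Fin 4)) → ℂ) ⊆ Metric.closedBall 0 R)
    (hR : ∀ μ : Fin 4, R + sch.a k * |(v μ : ℝ)| ≤ sch.a k * sch.L k) :
    qcdLatticeDist sch k n σ (translateMulti (sch.a k • siteToE v) G) = qcdLatticeDist sch k n σ G := by
  rw [qcdLatticeDist_apply sch k hn, qcdLatticeDist_apply sch k hn]
  have ha := sch.a_pos k
  -- the translate evaluated on the lattice
  have htrans : ∀ x : Fin n → Site 4,
      translateMulti (sch.a k • siteToE v) G (fun i => sch.a k • siteToE (x i)) =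
        G (fun i => sch.a k • siteToE (x i - v)) := by
    intro x
    rw [translateMulti_apply]
    congr 1
    funext i
    rw [Summit.QuantumFields.YangMills.Cruxes.ContinuumLimitOnTrajectory.TwoOrbitSynchronisation.Transl.smul_siteToE_sub
      (sch.a k) (x i) v]
  -- support control: if `G (a_k y) ≠ 0` then every `a_k |y i μ| ≤ R`
  have hsupp : ∀ y : Fin n → Site 4, G (fun i => sch.a k • siteToE (y i)) ≠ 0 →
      ∀ i μ, sch.a k * |(y i μ : ℝ)| ≤ R := by
    intro y hy i μ
    have hmem : (fun i => sch.a k • siteToE (y i)) ∈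
        Metric.closedBall (0 : Fin n → EuclideanSpace ℝ (Fin 4)) R :=
      hG (not_not.1 fun h => hy (image_eq_zero_of_notMem_tsupport h))
    rw [Metric.mem_closedBall, dist_zero_right] at hmem
    calc sch.a k * |(y i μ : ℝ)| = ‖(sch.a k • siteToE (y i)) μ‖ := by
          rw [PiLp.smul_apply, siteToE_apply, smul_eq_mul, norm_mul, Real.norm_of_nonneg ha.le,
            Real.norm_eq_abs]
      _ ≤ ‖sch.a k • siteToE (y i)‖ := PiLp.norm_apply_le _ _
      _ ≤ ‖fun i => sch.a k • siteToE (y i)‖ := norm_le_pi_norm (fun i => sch.a k • siteToE (y i)) i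
      _ ≤ R := hmem
  -- hence `y` and `y + v` lie in the box
  have hbox : ∀ y : Fin n → Site 4, G (fun i => sch.a k • siteToE (y i)) ≠ 0 →
      ∀ i, y i ∈ box 4 (sch.L k) ∧ y i + v ∈ box 4 (sch.L k) := by
    intro y hy i
    have h1 : ∀ μ, |y i μ| + |v μ| ≤ (sch.L k : ℤ) := by
      intro μ
      have h2 : sch.a k * |(y i μ : ℝ)| + sch.a k * |(v μ : ℝ)| ≤ sch.a k * sch.L k := by
        linarith [hsupp y hy i μ, hR μ]
      rw [← mul_add] at h2
      have h3 : |(y i μ : ℝ)| + |(v μ : ℝ)| ≤ sch.L k := le_of_mul_le_mul_left h2 ha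
      exact_mod_cast h3
    refine ⟨mem_box.2 fun μ => ?_, mem_box.2 fun μ => ?_⟩
    · exact abs_le.1 ((le_add_of_nonneg_right (abs_nonneg _)).trans (h1 μ))
    · exact abs_le.1 ((abs_add_le _ _).trans (h1 μ))
  -- the summands agree after the shift `y ↦ y + v`
  have hfg : ∀ y : Fin n → Site 4,
      qcdTorusMomentStr sch k σ (fun i => y i + v) *
          translateMulti (sch.a k • siteToE v) G (fun i => sch.a k • siteToE (y i + v)) =
        qcdTorusMomentStr sch k σ y * G (fun i => sch.a k • siteToE (y i)) := by
    intro y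
    rw [qcdTorusMomentStr_add_const, htrans]
    simp only [add_sub_cancel_right]
  refine Finset.sum_bij_ne_zero (fun x _ _ => fun i => x i - v) (fun x hx hne => ?_)
    (fun x₁ _ _ x₂ _ _ h => ?_) (fun y hy hne => ?_) (fun x hx hne => ?_)
  · -- lands in the box
    have hne' : G (fun i => sch.a k • siteToE (x i - v)) ≠ 0 := by
      rw [← htrans]; exact (mul_ne_zero_iff.1 hne).2
    exact Fintype.mem_piFinset.2 fun i => (hbox _ hne' i).1
  · -- injective
    exact funext fun i => sub_left_injective (congrFun h i)
  · -- surjective onto the support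
    have hne' : G (fun i => sch.a k • siteToE (y i)) ≠ 0 := (mul_ne_zero_iff.1 hne).2
    refine ⟨fun i => y i + v, Fintype.mem_piFinset.2 fun i => (hbox _ hne' i).2, ?_,
      funext fun i => add_sub_cancel_right _ _⟩
    rw [hfg]
    exact hne
  · -- the summands agree
    have h := hfg (fun i => x i - v)
    simp only [sub_add_cancel] at h
    exact h

/-! ### The four-term argument -/

/-- Schwartz norms are even. -/
theorem schwartzNorm_neg_eq {X : Type*} [NormedAddCommGroup X] [NormedSpace ℝ X] (M : ℕ) (G : 𝓢(X, ℂ)) :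
    schwartzNorm M (-G) = schwartzNorm M G :=
  map_neg_eq_map _ _

/-- Schwartz norms of differences are symmetric. -/
theorem schwartzNorm_sub_comm {X : Type*} [NormedAddCommGroup X] [NormedSpace ℝ X] (M : ℕ) (F G : 𝓢(X, ℂ)) :
    schwartzNorm M (F - G) = schwartzNorm M (G - F) := by
  rw [← neg_sub, schwartzNorm_neg_eq]

/-- Convergence to `0` in `𝓢` forces the Schwartz norms of finite order to tend to `0`. -/
theorem tendsto_schwartzNorm_of_tendsto_zero {X : Type*} [NormedAddCommGroup X] [NormedSpace ℝ X] (M : ℕ)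
    {Φ : ℕ → 𝓢(X, ℂ)} (hΦ : Tendsto Φ atTop (𝓝 0)) :
    Tendsto (fun j => schwartzNorm M (Φ j)) atTop (𝓝 0) := by
  have hqc : Continuous fun G : 𝓢(X, ℂ) => schwartzNorm M G :=
    Seminorm.continuous_finsetSup (s := Finset.Iic (M, M)) fun i _ =>
      (schwartz_withSeminorms ℂ X ℂ).continuous_seminorm i
  have h2 := (hqc.tendsto 0).comp hΦ
  rwa [show schwartzNorm M (0 : 𝓢(X, ℂ)) = 0 from map_zero _] at h2

/-- **Lattice vectors approximating a continuum vector.**  For spacings `a_k > 0`, `a_k → 0`, the rounded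
lattice vectors `v_k = round(a / a_k)` satisfy `a_k v_k → a` in `ℝ⁴` and `a_k |v_k μ| ≤ ‖a‖ + a_k / 2`. -/
theorem exists_lattice_approx (sch : QCDScheme Nf) (a : EuclideanSpace ℝ (Fin 4)) :
    ∃ v : ℕ → Site 4, Tendsto (fun k => sch.a k • siteToE (v k)) atTop (𝓝 a) ∧
      ∀ k μ, sch.a k * |(v k μ : ℝ)| ≤ ‖a‖ + sch.a k / 2 := by
  set v : ℕ → Site 4 := fun k μ => round (a μ / sch.a k) with hv
  -- coordinatewise `|a_k round(a_μ / a_k) − a_μ| ≤ a_k / 2`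
  have hcoord : ∀ k μ, |sch.a k * (v k μ : ℝ) - a μ| ≤ sch.a k / 2 := by
    intro k μ
    have ha := sch.a_pos k
    have h2 : sch.a k * (v k μ : ℝ) - a μ = sch.a k * ((v k μ : ℝ) - a μ / sch.a k) := by
      field_simp
    rw [h2, abs_mul, abs_of_pos ha]
    have h3 := abs_sub_round (a μ / sch.a k)
    rw [abs_sub_comm] at h3
    calc sch.a k * |(v k μ : ℝ) - a μ / sch.a k| ≤ sch.a k * (1 / 2) := mul_le_mul_of_nonneg_left h3 ha.le
      _ = sch.a k / 2 := by ring
  have happly : ∀ k μ, (sch.a k • siteToE (v k) : EuclideanSpace ℝ (Fin 4)) μ = sch.a k * (v k μ : ℝ) :=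
    fun k μ => by rw [PiLp.smul_apply, siteToE_apply, smul_eq_mul]
  refine ⟨v, ?_, fun k μ => ?_⟩
  · -- coordinatewise convergence is convergence in `ℝ⁴`
    have hc : ∀ μ, Tendsto (fun k => (sch.a k • siteToE (v k) : EuclideanSpace ℝ (Fin 4)) μ) atTop
        (𝓝 (a μ)) := by
      intro μ
      rw [tendsto_iff_norm_sub_tendsto_zero]
      have hg : Tendsto (fun k => sch.a k / 2) atTop (𝓝 0) := by simpa using sch.tendsto_a.div_const 2
      refine squeeze_zero (fun k => norm_nonneg _) (fun k => ?_) hg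
      rw [Real.norm_eq_abs, happly]
      exact hcoord k μ
    have hpi : Tendsto (fun k => WithLp.ofLp (sch.a k • siteToE (v k) : EuclideanSpace ℝ (Fin 4)))
        atTop (𝓝 (WithLp.ofLp a)) :=
      tendsto_pi_nhds.2 hc
    have h := ((PiLp.continuous_toLp 2 (fun _ : Fin 4 => ℝ)).tendsto (WithLp.ofLp a)).comp hpi
    rw [WithLp.toLp_ofLp] at h
    exact Tendsto.congr (fun k => by simp only [Function.comp_apply, WithLp.toLp_ofLp]) h
  · -- `a_k |v_k μ| ≤ |a μ| + a_k / 2 ≤ ‖a‖ + a_k / 2`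
    have h4 : |a μ| ≤ ‖a‖ := by
      simpa [Real.norm_eq_abs] using PiLp.norm_apply_le a μ
    have h5 := abs_sub_abs_le_abs_sub (sch.a k * (v k μ : ℝ)) (a μ)
    rw [abs_mul, abs_of_pos (sch.a_pos k)] at h5
    linarith [hcoord k μ]

/-- **Asymptotic translation invariance from a k-uniform E0′ bound** (generic scheme, fixed arity and
species string): if eventually `‖qcdLatticeDist sch k n σ G‖ ≤ C |G|_N` on `⁰𝒮ₙ`, then for every `a ∈ ℝ⁴`
and `F ∈ ⁰𝒮ₙ`, `qcdLatticeDist sch k n σ (F(· − a)) − qcdLatticeDist sch k n σ F → 0`. -/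
theorem tendsto_qcdLatticeDist_translateMulti_sub (sch : QCDScheme Nf) {n : ℕ} (σ : Fin n → QCDField Nf)
    {C : ℝ} (hC : 0 ≤ C) (N : ℕ)
    (hbd : ∀ᶠ k in atTop, ∀ G : 𝓢((Fin n → EuclideanSpace ℝ (Fin 4)), ℂ), IsOffDiagonal G →
      ‖qcdLatticeDist sch k n σ G‖ ≤ C * schwartzNorm N G)
    (a : EuclideanSpace ℝ (Fin 4)) (F : 𝓢((Fin n → EuclideanSpace ℝ (Fin 4)), ℂ)) (hF : IsOffDiagonal F) :
    Tendsto (fun k : ℕ => qcdLatticeDist sch k n σ (translateMulti a F) - qcdLatticeDist sch k n σ F)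
      atTop (𝓝 0) := by
  rcases Nat.eq_zero_or_pos n with rfl | hn
  · -- degree `0`: both are evaluation at the unique point
    have h0 : (fun k : ℕ => qcdLatticeDist sch k 0 σ (translateMulti a F) - qcdLatticeDist sch k 0 σ F) =
        fun _ => 0 := by
      funext k
      rw [qcdLatticeDist_zero_apply, qcdLatticeDist_zero_apply, translateMulti_apply, sub_eq_zero]
      exact congrArg F (Subsingleton.elim _ _)
    rw [h0]
    exact tendsto_const_nhds
  have hn' : n ≠ 0 := hn.ne'
  -- lattice vectors `a_k v_k → a`
  obtain ⟨v, hba, hvbd⟩ := exists_lattice_approx sch a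
  -- strong continuity of translations, in the Schwartz norm of order `N`
  have hτ : Tendsto (fun k => schwartzNorm N (translateMulti a F - translateMulti (sch.a k • siteToE (v k)) F))
      atTop (𝓝 0) := by
    have h1 : Tendsto (fun k => translateMulti (sch.a k • siteToE (v k)) F) atTop (𝓝 (translateMulti a F)) :=
      ((continuous_translateMulti F).tendsto a).comp hba
    have h2 :
        Tendsto (fun k => translateMulti a F - translateMulti (sch.a k • siteToE (v k)) F) atTop (𝓝 0) := by
      simpa using (tendsto_const_nhds (x := translateMulti a F)).sub h1
    exact tendsto_schwartzNorm_of_tendsto_zero N h2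
  rw [NormedAddGroup.tendsto_nhds_zero]
  intro ε hε
  have hε4 : 0 < ε / 4 := by positivity
  -- compact off-diagonal cutoffs `G j → F`
  obtain ⟨G, hGsupp, hGoff, hGlim⟩ :=
    Summit.QuantumFields.YangMills.Theorems.OSLegsFromFemtoAndGap.exists_offDiagonal_cutoff_tendsto F hF
  have hGN : Tendsto (fun j => schwartzNorm N (G j - F)) atTop (𝓝 0) := by
    refine tendsto_schwartzNorm_of_tendsto_zero N ?_
    simpa using hGlim.sub_const F
  -- the constant controlling translates by vectors of norm `≤ ‖a‖ + 1`
  set D : ℝ := (2 * (2 + ‖a‖)) ^ N with hD_def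
  have hD : 0 ≤ D := by positivity
  -- choose the cutoff index `j`
  obtain ⟨j, hj⟩ : ∃ j, C * (D + 1) * schwartzNorm N (G j - F) < ε / 4 := by
    have h := hGN.const_mul (C * (D + 1))
    rw [mul_zero] at h
    exact (h.eventually (gt_mem_nhds hε4)).exists
  have hGR :
      tsupport (G j : (Fin n → EuclideanSpace ℝ (Fin 4)) → ℂ) ⊆ Metric.closedBall 0 (2 * ((j : ℝ) + 1)) :=
    fun x hx => (hGsupp j hx).2
  -- eventually in `k`: the E0′ bound, `‖a_k v_k − a‖ < 1`, term 1 small, the box is large, `a_k ≤ 1`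
  have hev2 : ∀ᶠ k in atTop, ‖sch.a k • siteToE (v k) - a‖ < 1 :=
    (tendsto_iff_norm_sub_tendsto_zero.1 hba).eventually (gt_mem_nhds one_pos)
  have hev3 : ∀ᶠ k in atTop,
      C * schwartzNorm N (translateMulti a F - translateMulti (sch.a k • siteToE (v k)) F) < ε / 4 := by
    have h := hτ.const_mul C
    rw [mul_zero] at h
    exact h.eventually (gt_mem_nhds hε4)
  have hev4 : ∀ᶠ k in atTop, 2 * ((j : ℝ) + 1) + ‖a‖ + 1 ≤ sch.a k * sch.L k :=
    tendsto_atTop.1 sch.tendsto_L _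
  have hev5 : ∀ᶠ k in atTop, sch.a k ≤ 2 := sch.tendsto_a.eventually (ge_mem_nhds two_pos)
  filter_upwards [hbd, hev2, hev3, hev4, hev5] with k hk1 hk2 hk3 hk4 hk5
  -- the exact lattice step for the cutoff
  have hlat : qcdLatticeDist sch k n σ (translateMulti (sch.a k • siteToE (v k)) (G j)) =
      qcdLatticeDist sch k n σ (G j) := by
    refine qcdLatticeDist_translateMulti_lattice_eq sch k hn' σ (v k) (G j) hGR fun μ => ?_
    have := hvbd k μ
    linarith
  -- the four-term split
  have hsplit : qcdLatticeDist sch k n σ (translateMulti a F) - qcdLatticeDist sch k n σ F =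
      qcdLatticeDist sch k n σ (translateMulti a F - translateMulti (sch.a k • siteToE (v k)) F) +
      qcdLatticeDist sch k n σ (translateMulti (sch.a k • siteToE (v k)) (F - G j)) +
      (qcdLatticeDist sch k n σ (translateMulti (sch.a k • siteToE (v k)) (G j)) -
        qcdLatticeDist sch k n σ (G j)) +
      qcdLatticeDist sch k n σ (G j - F) := by
    simp only [map_sub]
    ring
  rw [hsplit, hlat, sub_self, add_zero]
  -- term 1: continuity of translations
  have hb1 : ‖qcdLatticeDist sch k n σ (translateMulti a F - translateMulti (sch.a k • siteToE (v k)) F)‖ <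
      ε / 4 :=
    (hk1 _ ((hF.translateMulti a).sub (hF.translateMulti _))).trans_lt hk3
  -- term 2: translates of `F − G j` by bounded vectors
  have hb2 : ‖qcdLatticeDist sch k n σ (translateMulti (sch.a k • siteToE (v k)) (F - G j))‖ ≤
      C * (D * schwartzNorm N (G j - F)) := by
    refine (hk1 _ ((hF.sub (hGoff j)).translateMulti _)).trans (mul_le_mul_of_nonneg_left ?_ hC)
    refine (schwartzNorm_translateMulti_le _ _ _).trans ?_
    have hbk : ‖sch.a k • siteToE (v k)‖ ≤ ‖a‖ + 1 := by
      have := norm_le_norm_add_norm_sub' (sch.a k • siteToE (v k)) a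
      linarith
    rw [schwartzNorm_sub_comm]
    refine mul_le_mul_of_nonneg_right ?_ (schwartzNorm_nonneg _ _)
    exact pow_le_pow_left₀ (by positivity) (by linarith) _
  -- term 4: `G j → F`
  have hb4 : ‖qcdLatticeDist sch k n σ (G j - F)‖ ≤ C * schwartzNorm N (G j - F) :=
    hk1 _ ((hGoff j).sub hF)
  have hsum : C * (D * schwartzNorm N (G j - F)) + C * schwartzNorm N (G j - F) =
      C * (D + 1) * schwartzNorm N (G j - F) := by ring
  have htri : ‖qcdLatticeDist sch k n σ (translateMulti a F - translateMulti (sch.a k • siteToE (v k)) F) +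
      qcdLatticeDist sch k n σ (translateMulti (sch.a k • siteToE (v k)) (F - G j)) +
      qcdLatticeDist sch k n σ (G j - F)‖ ≤
      ‖qcdLatticeDist sch k n σ (translateMulti a F - translateMulti (sch.a k • siteToE (v k)) F)‖ +
      ‖qcdLatticeDist sch k n σ (translateMulti (sch.a k • siteToE (v k)) (F - G j))‖ +
      ‖qcdLatticeDist sch k n σ (G j - F)‖ := norm_add₃_le
  linarith

/-- (AT) **Stub `stub_asymptoticTranslation`: asymptotic translation invariance on `⁰𝒮`.**  Along the
calibrated scheme `𝒞.scheme m`, GIVEN the k-uniform E0′ bound (P2) on the canonical lattice distributions,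
`qcdLatticeDist (𝒞.scheme m) k n σ (F(· − a)) − qcdLatticeDist (𝒞.scheme m) k n σ F → 0` for every
translation `a ∈ ℝ⁴` and every off-diagonal `F` (P6) — by `tendsto_qcdLatticeDist_translateMulti_sub` with
`C = α (n!)^β`, `N = n s`; the remaining crux hypotheses are not used. -/
theorem stub_asymptoticTranslation : ∀ (Nf : ℕ) (reg : QCDRegularisation Nf) (𝒞 : CalibratedSpeciesFamily reg) (m : Fin Nf → ℝ), (∀ f, 0 < m f) → (𝒞.scheme m).HasAsymptoticScaling → (∀ fl : Fin Nf, ∀ᶠ k in Filter.atTop, -1 < (𝒞.scheme m).mq fl k) → (∃ Δ > 0, (𝒞.scheme m).HasLatticeMassGap Δ) → (∀ᶠ k in Filter.atTop, (𝒞.scheme m).twoPoint k QCDField.glue QCDField.glue (thetaTest 4 𝒞.f₀) 𝒞.f₀ = 1) → (∀ f g : Fin Nf, f ≠ g → ∀ᶠ k in Filter.atTop, (𝒞.scheme m).twoPoint k (QCDField.pseudoRe f g) (QCDField.pseudoRe f g) (thetaTest 4 𝒞.f₀) 𝒞.f₀ = 1) → (∀ n : ℕ, n ≠ 0 → ∀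 (σ : Fin n → QCDField Nf) (f : Fin n → SchwartzMap (EuclideanSpace ℝ (Fin 4)) ℝ) (F : SchwartzMap (Fin n → EuclideanSpace ℝ (Fin 4)) ℂ), IsTensorOf F (fun i => ofRealTest (f i)) → IsOffDiagonal F → ∃ c : ℂ, Filter.Tendsto (fun k : ℕ => qcdLatticeSchwinger (𝒞.scheme m) k n σ f) Filter.atTop (nhds c)) → ∀ (s : ℕ) (α β : ℝ), 0 ≤ α → (∀ (n : ℕ) (σ : Fin n → QCDField Nf), ∀ᶠ k in Filter.atTop, ∀ F : SchwartzMap (Fin n → EuclideanSpace ℝ (Fin 4)) ℂ, IsOffDiagonal F → ‖qcdLatticeDist (𝒞.scheme m) k n σ F‖ ≤ α * (n.factorial : ℝ) ^ β * schwartzNorm (n * s) F) → (∀ (n : ℕ) (σ : Fin n → QCDField Nf) (a : EuclideanSpace ℝ (Fin 4)) (F : SchwartzMap (Fin n → EuclideanSpace ℝ (Fin 4)) ℂ), IsOffDiagonal F → Filter.Tendsto (fun k : ℕ => qcdLatticeDist (𝒞.scheme m) k n σ (translateMulti a F) - qcdLatticeDist (𝒞.scheme m) k n σ F) Filter.atTop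 (nhds 0)) := by
  intro Nf reg 𝒞 m _hm _hAS _hbr _hgap _h2g _h2q _hconv s α β hα hb n σ a F hF
  exact tendsto_qcdLatticeDist_translateMulti_sub (𝒞.scheme m) σ
    (mul_nonneg hα (Real.rpow_nonneg (Nat.cast_nonneg _) β)) (n * s) (hb n σ) a F hF

end Summit.QuantumFields.QCD.Theorems.ConvergentOSClosure

end
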